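import Mathlib

/-!
# Kill `3T+Q`: three bond triangles and one quad corner cannot fill a fan star

Worker lemma `stub_kill3TQ` of the crux `GappedShellCensus.ShellTrichotomy`
(line `Sketch`, census half).

The census half of the crux abstracts the fan triangulation of a radially projected 12-point
shell into finite data: a bond graph `bond` on `Fin 12`, the fan triangles `tri` (3-sets of
labels) and the fan angles `ang S v` (nonnegative, zero off `S`, summing to `2π` around every
label).  A corner of a bond triangle is `≤ arccos (1/4)` and a quad corner is
`≤ 2·arccos (807/2000)`.  A label `v` whose fan star consists of the bond triangles
`{v,a,b}`, `{v,b,c}`, `{v,c,d}` and the quad corner `{v,d,a}` (fourth vertex `x`) is therefore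
impossible: `2π = Σ_{S ∈ tri} ang S v ≤ 3·arccos (1/4) + 2·arccos (807/2000) < 2π`.

The numerical inequality is proved from `cos (3·arccos (1/4)) = -11/16`,
`cos (2·arccos (807/2000)) = -1348751/2000000` and strict antitonicity of `cos` on `[0, π]`.
-/

noncomputable section

namespace Summit.AtomisticToContinuum.Crystallization.Theorems

open Real

/-- `π/3 < arccos (1/4) < π/2`. -/
private theorem arccos_quarter_bounds : π / 3 < arccos (1 / 4) ∧ arccos (1 / 4) < π / 2 := by
  constructor
  · rw [← arccos_cos (x := π / 3) (by positivity) (by linarith [pi_pos]), cos_pi_div_three]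
    exact arccos_lt_arccos (by norm_num) (by norm_num) (by norm_num)
  · rw [← arccos_zero]
    exact arccos_lt_arccos (by norm_num) (by norm_num) (by norm_num)

/-- `π/3 < arccos (807/2000) < π/2`. -/
private theorem arccos_807_bounds : π / 3 < arccos (807 / 2000) ∧ arccos (807 / 2000) < π / 2 := by
  constructor
  · rw [← arccos_cos (x := π / 3) (by positivity) (by linarith [pi_pos]), cos_pi_div_three]
    exact arccos_lt_arccos (by norm_num) (by norm_num) (by norm_num)
  · rw [← arccos_zero]
    exact arccos_lt_arccos (by norm_num) (by norm_num) (by norm_num)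

/-- `cos (3 · arccos (1/4)) = −11/16`. -/
private theorem cos_three_arccos_quarter : cos (3 * arccos (1 / 4)) = -11 / 16 := by
  rw [cos_three_mul, cos_arccos (by norm_num) (by norm_num)]
  norm_num

/-- `cos (2 · arccos (807/2000)) = −1348751/2000000`. -/
private theorem cos_two_arccos_807 : cos (2 * arccos (807 / 2000)) = -1348751 / 2000000 := by
  rw [cos_two_mul, cos_arccos (by norm_num) (by norm_num)]
  norm_num

/-- **The `3T+Q` angle budget fails:** `3·arccos(1/4) + 2·arccos(807/2000) < 2π`
(numerically `3.9543 + 2.3109 = 6.2652 < 6.2832`). -/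
private theorem three_arccos_quarter_add_two_arccos_807_lt_two_pi :
    3 * arccos (1 / 4) + 2 * arccos (807 / 2000) < 2 * π := by
  obtain ⟨ha1, ha2⟩ := arccos_quarter_bounds
  obtain ⟨hb1, hb2⟩ := arccos_807_bounds
  set a := arccos (1 / 4) with ha
  set b := arccos (807 / 2000) with hb
  -- x' := 2π − 3a and y' := 2b both lie in [0, π]
  have hx0 : 0 ≤ 2 * π - 3 * a := by linarith
  have hxπ : 2 * π - 3 * a ≤ π := by linarith
  have hy0 : 0 ≤ 2 * b := by linarith [pi_pos]
  have hyπ : 2 * b ≤ π := by linarith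
  -- cos x' = cos (3a) = −11/16 < cos (2b)
  have hcx : cos (2 * π - 3 * a) = -11 / 16 := by
    rw [cos_sub, cos_two_pi, sin_two_pi, cos_three_arccos_quarter]; ring
  have hcy : cos (2 * b) = -1348751 / 2000000 := cos_two_arccos_807
  have hlt : cos (2 * π - 3 * a) < cos (2 * b) := by rw [hcx, hcy]; norm_num
  -- cos strictly decreasing on [0, π] ⇒ 2b < 2π − 3a
  have key : 2 * b < 2 * π - 3 * a := by
    by_contra h
    push Not at h
    have := Real.strictAntiOn_cos.antitoneOn (Set.mem_Icc.2 ⟨hx0, hxπ⟩) (Set.mem_Icc.2 ⟨hy0, hyπ⟩) h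
    linarith
  linarith

/-- For a nonnegative function, the sum over `insert p s` is at most `f p` plus the sum over `s`
(equality unless `p ∈ s`). -/
private theorem sum_insert_le_add {ι : Type*} [DecidableEq ι] (f : ι → ℝ) (hf : ∀ i, 0 ≤ f i)
    (p : ι) (s : Finset ι) : ∑ i ∈ insert p s, f i ≤ f p + ∑ i ∈ s, f i := by
  by_cases hp : p ∈ s
  · rw [Finset.insert_eq_of_mem hp]
    linarith [hf p]
  · rw [Finset.sum_insert hp]

/-- A triple `{p, q, r}` of pairwise bonded labels is a bond triangle: any two distinct members
are bonded. -/
private theorem bond_of_mem_triple (bond : Fin 12 → Fin 12 → Bool)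
    (bond_symm : ∀ v w, bond v w = bond w v) (p q r : Fin 12) (hpq : bond p q = true)
    (hqr : bond q r = true) (hpr : bond p r = true) :
    ∀ y ∈ ({p, q, r} : Finset (Fin 12)), ∀ z ∈ ({p, q, r} : Finset (Fin 12)),
      y ≠ z → bond y z = true := by
  intro y hy z hz hne
  simp only [Finset.mem_insert, Finset.mem_singleton] at hy hz
  rcases hy with rfl | rfl | rfl <;> rcases hz with rfl | rfl | rfl <;>
    first
    | exact absurd rfl hne
    | assumption
    | (rw [bond_symm]; assumption)

/-- **Kill `3T+Q`.** A label whose fan star is three bond triangles `{v,a,b}`, `{v,b,c}`,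
`{v,c,d}` and one quad corner `{v,d,a}` (with `d`, `a` not bonded and fourth vertex `x` bonded
to `d` and `a` but not to `v`) is impossible: the fan angles at `v` sum to `2π`, but the four
corners sum to at most `3·arccos (1/4) + 2·arccos (807/2000) < 2π`. -/
theorem stub_kill3TQ (bond : Fin 12 → Fin 12 → Bool) (tri : Finset (Finset (Fin 12)))
    (ang : Finset (Fin 12) → Fin 12 → ℝ) (bond_symm : ∀ v w, bond v w = bond w v)
    (ang_nonneg : ∀ S v, 0 ≤ ang S v) (ang_zero : ∀ S v, v ∉ S → ang S v = 0)
    (sum_ang : ∀ v, ∑ S ∈ tri, ang S v = 2 * Real.pi)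
    (tCorner : ∀ S ∈ tri, (∀ v ∈ S, ∀ w ∈ S, v ≠ w → bond v w = true) → ∀ v ∈ S, ang S v ≤ Real.arccos (1 / 4))
    (qCorner : ∀ v d a x, ({v, d, a} : Finset (Fin 12)) ∈ tri → bond v d = true → bond v a = true →
      bond d a = false → d ≠ a → bond d x = true → bond x a = true → bond v x = false → x ≠ v →
      ang {v, d, a} v ≤ 2 * Real.arccos (807 / 2000))
    (v a b c d x : Fin 12)
    (hstar : (tri.filter fun S => v ∈ S) = {{v, a, b}, {v, b, c}, {v, c, d}, {v, d, a}})
    (hva : bond v a = true) (hvb : bond v b = true) (hvc : bond v c = true) (hvd : bond v d = true)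
    (hab : bond a b = true) (hbc : bond b c = true) (hcd : bond c d = true) (hda : bond d a = false)
    (hda' : d ≠ a) (hdx : bond d x = true) (hxa : bond x a = true) (hvx : bond v x = false) (hxv : x ≠ v) :
    False := by
  -- (1) only the triangles of the star of `v` contribute to the angle sum at `v`
  have hsum : ∑ S ∈ tri, ang S v = ∑ S ∈ tri.filter (fun S => v ∈ S), ang S v := by
    rw [Finset.sum_filter]
    refine Finset.sum_congr rfl fun S _ => ?_
    split_ifs with h
    · rfl
    · exact ang_zero S v h
  have h2pi : ∑ S ∈ ({{v, a, b}, {v, b, c}, {v, c, d}, {v, d, a}} : Finset (Finset (Fin 12))),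
      ang S v = 2 * π := by
    rw [← hstar, ← hsum, sum_ang v]
  -- (2) the sum over the (possibly non-distinct) literal is at most the sum of the four corners
  have hle : ∑ S ∈ ({{v, a, b}, {v, b, c}, {v, c, d}, {v, d, a}} : Finset (Finset (Fin 12))),
      ang S v ≤ ang {v, a, b} v + (ang {v, b, c} v + (ang {v, c, d} v + ang {v, d, a} v)) := by
    have hf : ∀ S : Finset (Fin 12), 0 ≤ (fun S => ang S v) S := fun S => ang_nonneg S v
    refine (sum_insert_le_add (fun S => ang S v) hf _ _).trans ?_
    refine add_le_add le_rfl ((sum_insert_le_add (fun S => ang S v) hf _ _).trans ?_)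
    refine add_le_add le_rfl ((sum_insert_le_add (fun S => ang S v) hf _ _).trans ?_)
    rw [Finset.sum_singleton]
  -- (3) the four triangles of the star belong to `tri`
  have memF : ∀ S ∈ ({{v, a, b}, {v, b, c}, {v, c, d}, {v, d, a}} : Finset (Finset (Fin 12))),
      S ∈ tri := by
    intro S hS
    rw [← hstar] at hS
    exact (Finset.mem_filter.1 hS).1
  have m1 : ({v, a, b} : Finset (Fin 12)) ∈ tri := memF _ (Finset.mem_insert_self _ _)
  have m2 : ({v, b, c} : Finset (Fin 12)) ∈ tri :=
    memF _ (Finset.mem_insert_of_mem (Finset.mem_insert_self _ _))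
  have m3 : ({v, c, d} : Finset (Fin 12)) ∈ tri :=
    memF _ (Finset.mem_insert_of_mem (Finset.mem_insert_of_mem (Finset.mem_insert_self _ _)))
  have m4 : ({v, d, a} : Finset (Fin 12)) ∈ tri :=
    memF _ (Finset.mem_insert_of_mem (Finset.mem_insert_of_mem (Finset.mem_insert_of_mem
      (Finset.mem_singleton_self _))))
  -- (4) the three bond-triangle corners and the quad corner
  have h1 : ang {v, a, b} v ≤ arccos (1 / 4) :=
    tCorner _ m1 (bond_of_mem_triple bond bond_symm v a b hva hab hvb) v
      (Finset.mem_insert_self _ _)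
  have h2 : ang {v, b, c} v ≤ arccos (1 / 4) :=
    tCorner _ m2 (bond_of_mem_triple bond bond_symm v b c hvb hbc hvc) v
      (Finset.mem_insert_self _ _)
  have h3 : ang {v, c, d} v ≤ arccos (1 / 4) :=
    tCorner _ m3 (bond_of_mem_triple bond bond_symm v c d hvc hcd hvd) v
      (Finset.mem_insert_self _ _)
  have h4 : ang {v, d, a} v ≤ 2 * arccos (807 / 2000) :=
    qCorner v d a x m4 hvd hva hda hda' hdx hxa hvx hxv
  -- (5) the numerical budget
  have hnum := three_arccos_quarter_add_two_arccos_807_lt_two_pi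
  linarith

end Summit.AtomisticToContinuum.Crystallization.Theorems

end
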